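import Literature.Analysis.FluidPDE.AxisymSwirlGradientCurl
import Literature.Analysis.FluidPDE.AxisymQuotientBounds
import HarnessLib
/-!
# The angular velocity of an axisymmetric flow is at most half its maximal vorticity: the swirl funnel
# `|Γ| ≤ ½ Ω r²`, and «vorticity Type I ⇒ angular-velocity Type I» (zone Z1 TEMPLATE (C7) swirl profile and (G2) swirl
# gauge N-b, read against a vorticity bound — kernel, unconditional)

HONEST FRAMING (cell ns-blowup GROUP B «PROFILE SEARCH», zone Z1 «Type-II log-modulated DSS ansatz for axisymmetric
Navier–Stokes — the template IS the deliverable»; D-0035/D-0074): part XL of the Z1 dictionary. The TEMPLATE reads the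
swirl `Γ = r u_θ` of a candidate through its radial sup-profile (C7) and normalises by the swirl angular velocity at the
centre, `λ_b(t) := u₁(x_c(t), t)^{−1/2}`, `u₁ = u_θ/r` (gauge N-b, (G2)). This file records what a bound on the VORTICITY
ALONE says about both, for any axisymmetric field — by integrating Majda–Bertozzi's (2.64) (`∂ᵣΓ = rω³`, `∂_zΓ = −rωʳ`;
the tree's `Literature.Analysis.FluidPDE.IsAxisymmetric.abs_fderiv_swirl_apply_le`, `|DΓ(x)h| ≤ r‖ω(x)‖‖h‖`) along the
horizontal ray from the axis, where `Γ` vanishes: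

* `abs_swirl_le_of_norm_curl_le_segment` — **the swirl funnel**: `|Γ(x)| ≤ ½ Ω r(x)²` whenever `‖curl u‖ ≤ Ω` on the
  horizontal segment from the axis foot `(0, 0, x₂)` to `x` (and `u` is differentiable there);
* `abs_swirl_le_of_norm_curl_le`, `abs_swirlVelocity_le_of_norm_curl_le`, `abs_angVelQuot_le_of_norm_curl_le` — global
  forms under `‖curl u‖ ≤ Ω` on `ℝ³`: `|Γ| ≤ ½Ωr²`, `|u_θ| ≤ ½Ωr`, and `|u_θ/r| ≤ ½Ω` at EVERY point (axis included, for
  `u ∈ C²`, via the smooth Hou–Li quotient `angVelQuot`) — **the angular velocity never exceeds half the maximal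
  vorticity**;
* `abs_swirl_rotGen_eq_half_norm_curl_mul` — the constant `½` is attained by the rigid rotation `x ↦ Jx`
  (`‖curl‖ ≡ 2`, `Γ = r²`; Majda–Bertozzi's rotating example);
* `eventually_abs_swirl_le_of_vorticityRate`, `eventually_abs_angVelQuot_le_of_vorticityRate` — for a time-dependent
  family `u(t, ·)` with axisymmetric `C²` slices near `T⁻` obeying the vorticity RATE `(T − t)‖curl u(t)‖_∞ ≤ C`
  (the certificate class of crux `CertifiedBlowupVorticityRateBlowup`, stmt-NavierStokesRegularity-8639, is of this kind):
  eventually `(T − t)|Γ(t, x)| ≤ ½ C r(x)²` and `(T − t)|u_θ/r|(t, x) ≤ ½ C` for all `x` — **VORTICITY TYPE I ⇒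
  ANGULAR-VELOCITY TYPE I**, with the sharp constant `½`. TEMPLATE readings: (C7) the radial swirl profile at the
  parabolic scale is at most quadratic, `|Γ(t, √(T−t) ρ e)| ≤ ½Cρ²`; (G2) the swirl gauge is Type-I-slow,
  `λ_b(t)² = 1/|u₁(x_c(t), t)| ≥ 2(T − t)/C`.

WHY NO REGULARITY WORD FOLLOWS (honest framing): `(T − t)‖u_θ/r‖_∞ ≤ C/2` is the weak-`L¹`-in-time endpoint; the mixed-norm
criteria on the angular velocity / swirl component in print (Neustupa–Pokorný, Kubica–Pokorný–Zajączkowski and successors;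
the swirl criteria of Wei 2016 / Lei–Zhang 2017 in the tree, `Wei2016_logModulus_regularity`) need strong integrability in
time or smallness at the axis uniformly in `t`, which the rate misses by a logarithm. Nothing here is specific to
Navier–Stokes: pure calculus of axisymmetric fields plus bookkeeping of a rate. **Nothing asserts that a blow-up or a
certificate-class witness exists.** «violates: n/a — dictionary»; bears_on LADDER-NS N5/Z1 → N1 (crux 8639 certificate
class; TEMPLATE (C7)/(G2)). Author: ns-blowup-profile-eng-1 g10, 2026-08-27.
-/

open Real Filter Topology Set
open Literature.Analysis.FluidPDE

namespace Summit.NavierStokesRegularity.OSWSelfSimilar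
namespace TypeIIModulationDictionary

/-! ### The swirl funnel `|Γ| ≤ ½ Ω r²` -/

section Funnel

variable {u : EuclideanSpace ℝ (Fin 3) → EuclideanSpace ℝ (Fin 3)} {x : EuclideanSpace ℝ (Fin 3)} {Ω : ℝ}

/-- `‖w‖² = w₀² + w₁² + w₂²` on `ℝ³` (private copy; the tree's `Literature.Algebra.EuclideanLattices.norm_sq_fin_three`
lives in an unrelated lattice module). [new here — bookkeeping] -/
private theorem norm_sq_eq_add_three (w : EuclideanSpace ℝ (Fin 3)) : ‖w‖ ^ 2 = w 0 ^ 2 + w 1 ^ 2 + w 2 ^ 2 := by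
  rw [EuclideanSpace.norm_sq_eq, Fin.sum_univ_three]
  simp only [Real.norm_eq_abs, sq_abs]

/-- **The swirl funnel `|Γ(x)| ≤ ½ Ω r(x)²` from a vorticity bound on the horizontal segment to the axis.** Let `u` be
axisymmetric, differentiable at every point `(τx₀, τx₁, x₂)`, `0 ≤ τ ≤ 1`, of the horizontal segment joining the axis foot
`a = (0, 0, x₂)` to `x`, with `‖curl u‖ ≤ Ω` there. Then `|swirl u x| ≤ Ω/2 · r(x)²`: along the segment
`g(τ) = Γ(a + τ(x − a))` has `g(0) = 0` (the swirl vanishes on the axis) and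
`|g'(τ)| ≤ r(a + τ(x−a))‖ω‖‖x − a‖ ≤ Ωr²τ` (`IsAxisymmetric.abs_fderiv_swirl_apply_le`), and `∫₀¹ Ωr²τ dτ = ½Ωr²`.
[new here — dictionary] -/
theorem abs_swirl_le_of_norm_curl_le_segment (hax : IsAxisymmetric u)
    (hd : ∀ τ ∈ Icc (0 : ℝ) 1, DifferentiableAt ℝ u
      (EuclideanSpace.single 2 (x 2) + τ • (x - EuclideanSpace.single 2 (x 2))))
    (hΩ : ∀ τ ∈ Icc (0 : ℝ) 1,
      ‖curl u (EuclideanSpace.single 2 (x 2) + τ • (x - EuclideanSpace.single 2 (x 2)))‖ ≤ Ω) :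
    |swirl u x| ≤ Ω / 2 * cylRadius x ^ 2 := by
  set a : EuclideanSpace ℝ (Fin 3) := EuclideanSpace.single 2 (x 2) with ha_def
  set v : EuclideanSpace ℝ (Fin 3) := x - a with hv_def
  set γ : ℝ → EuclideanSpace ℝ (Fin 3) := fun τ => a + τ • v with hγ_def
  -- geometry of the segment
  have hv0 : v 0 = x 0 := by simp [hv_def, ha_def]
  have hv1 : v 1 = x 1 := by simp [hv_def, ha_def]
  have hv2 : v 2 = 0 := by simp [hv_def, ha_def]
  have hγ0 : ∀ τ, γ τ 0 = τ * x 0 := fun τ => by simp [hγ_def, ha_def, hv0]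
  have hγ1 : ∀ τ, γ τ 1 = τ * x 1 := fun τ => by simp [hγ_def, ha_def, hv1]
  have hcyl : ∀ τ, 0 ≤ τ → cylRadius (γ τ) = τ * cylRadius x := fun τ hτ => by
    rw [cylRadius, cylRadius, hγ0, hγ1, show (τ * x 0) ^ 2 + (τ * x 1) ^ 2 = τ ^ 2 * (x 0 ^ 2 + x 1 ^ 2) by ring,
      Real.sqrt_mul (sq_nonneg τ), Real.sqrt_sq hτ]
  have hnv : ‖v‖ = cylRadius x := by
    have h2 : ‖v‖ ^ 2 = cylRadius x ^ 2 := by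
      rw [norm_sq_eq_add_three, cylRadius_sq, hv0, hv1, hv2]; ring
    rw [← Real.sqrt_sq (norm_nonneg v), h2, Real.sqrt_sq (cylRadius_nonneg x)]
  have hγone : γ 1 = x := by simp [hγ_def, hv_def]
  have hγzero : γ 0 = a := by simp [hγ_def]
  have ha_axis : cylRadius a = 0 := by
    rw [cylRadius_eq_zero_iff]; simp [ha_def]
  have hΩ0 : 0 ≤ Ω := (norm_nonneg _).trans (hΩ 0 ⟨le_rfl, zero_le_one⟩)
  -- the swirl along the segment and its derivative
  have hγd : ∀ τ, HasDerivAt γ v τ := fun τ => by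
    have h := ((hasDerivAt_id τ).smul_const v).const_add a
    simpa [hγ_def] using h
  have hgd : ∀ τ ∈ Icc (0 : ℝ) 1, HasDerivAt (fun τ => swirl u (γ τ)) (fderiv ℝ (swirl u) (γ τ) v) τ := by
    intro τ hτ
    have h2 : HasFDerivAt (swirl u) (fderiv ℝ (swirl u) (γ τ)) (γ τ) :=
      (differentiableAt_swirl (hd τ hτ)).hasFDerivAt
    exact h2.comp_hasDerivAt τ (hγd τ)
  have hgc : ContinuousOn (fun τ => swirl u (γ τ)) (Icc 0 1) :=
    fun τ hτ => (hgd τ hτ).continuousAt.continuousWithinAt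
  -- comparison with `B(τ) = ½Ωr²τ²`
  have hB : ∀ τ, HasDerivAt (fun τ : ℝ => Ω / 2 * cylRadius x ^ 2 * τ ^ 2) (Ω * cylRadius x ^ 2 * τ) τ := by
    intro τ
    have h := (hasDerivAt_pow 2 τ).const_mul (Ω / 2 * cylRadius x ^ 2)
    simp only [Nat.cast_ofNat, Nat.add_one_sub_one, pow_one] at h
    exact h.congr_deriv (by ring)
  have key := image_norm_le_of_norm_deriv_right_le_deriv_boundary (a := (0 : ℝ)) (b := 1) hgc
    (fun τ hτ => (hgd τ (Ico_subset_Icc_self hτ)).hasDerivWithinAt)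
    (B := fun τ : ℝ => Ω / 2 * cylRadius x ^ 2 * τ ^ 2) (B' := fun τ => Ω * cylRadius x ^ 2 * τ)
    (by simp [hγzero, swirl_eq_zero_of_cylRadius_eq_zero u ha_axis]) hB
    (fun τ hτ => by
      rw [Real.norm_eq_abs]
      calc |fderiv ℝ (swirl u) (γ τ) v| ≤ cylRadius (γ τ) * ‖curl u (γ τ)‖ * ‖v‖ :=
            hax.abs_fderiv_swirl_apply_le (hd τ (Ico_subset_Icc_self hτ)) v
        _ = (τ * cylRadius x ^ 2) * ‖curl u (γ τ)‖ := by rw [hcyl τ hτ.1, hnv]; ring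
        _ ≤ (τ * cylRadius x ^ 2) * Ω :=
            mul_le_mul_of_nonneg_left (hΩ τ (Ico_subset_Icc_self hτ)) (by have := hτ.1; positivity)
        _ = Ω * cylRadius x ^ 2 * τ := by ring)
  have h1 := key (right_mem_Icc.2 zero_le_one)
  simpa [hγone, Real.norm_eq_abs] using h1

/-- **`|Γ(x)| ≤ ½ Ω r(x)²` everywhere** for an axisymmetric differentiable field with `‖curl u‖ ≤ Ω` on `ℝ³`.
[new here — dictionary] -/
theorem abs_swirl_le_of_norm_curl_le (hax : IsAxisymmetric u) (hd : Differentiable ℝ u)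
    (hΩ : ∀ y, ‖curl u y‖ ≤ Ω) (x : EuclideanSpace ℝ (Fin 3)) : |swirl u x| ≤ Ω / 2 * cylRadius x ^ 2 :=
  abs_swirl_le_of_norm_curl_le_segment hax (fun _ _ => hd _) (fun _ _ => hΩ _)

/-- **`|u_θ(x)| ≤ ½ Ω r(x)`**: the swirl velocity of an axisymmetric differentiable field with `‖curl u‖ ≤ Ω` grows at
most linearly off the axis, with slope half the vorticity bound. [new here — dictionary] -/
theorem abs_swirlVelocity_le_of_norm_curl_le (hax : IsAxisymmetric u) (hd : Differentiable ℝ u)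
    (hΩ : ∀ y, ‖curl u y‖ ≤ Ω) (x : EuclideanSpace ℝ (Fin 3)) : |swirlVelocity u x| ≤ Ω / 2 * cylRadius x := by
  rcases eq_or_ne (cylRadius x) 0 with hr | hr
  · -- on the axis the junk-free convention gives `u_θ = 0`
    have : swirlVelocity u x = 0 := by
      simp [swirlVelocity, eTheta, hr]
    rw [this, hr, abs_zero, mul_zero]
  · have hpos : 0 < cylRadius x := lt_of_le_of_ne (cylRadius_nonneg x) (Ne.symm hr)
    have h := abs_swirl_le_of_norm_curl_le hax hd hΩ x
    rw [swirl_eq_cylRadius_mul_swirlVelocity u hr, abs_mul, abs_of_pos hpos] at h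
    have h' : cylRadius x * |swirlVelocity u x| ≤ cylRadius x * (Ω / 2 * cylRadius x) := by
      calc _ ≤ Ω / 2 * cylRadius x ^ 2 := h
        _ = cylRadius x * (Ω / 2 * cylRadius x) := by ring
    exact le_of_mul_le_mul_left h' hpos

/-- **The angular velocity of an axisymmetric flow is at most half its maximal vorticity**: for an axisymmetric
`u ∈ C²` with `‖curl u‖ ≤ Ω` on `ℝ³`, the smooth Hou–Li variable `u_θ/r = angVelQuot u` (TEMPLATE's `u₁`) obeys
`|u_θ/r| ≤ Ω/2` at EVERY point, axis included (off the axis from `r² · (u_θ/r) = Γ`; across the axis by continuity).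
[new here — dictionary] -/
theorem abs_angVelQuot_le_of_norm_curl_le (hax : IsAxisymmetric u) (hu : ContDiff ℝ 2 u)
    (hΩ : ∀ y, ‖curl u y‖ ≤ Ω) (x : EuclideanSpace ℝ (Fin 3)) : |angVelQuot u x| ≤ Ω / 2 := by
  have hd : Differentiable ℝ u := hu.differentiable two_ne_zero
  have hΦc : Continuous (angVelQuot u) := (contDiff_angVelQuot (n := 0) (by exact_mod_cast hu)).continuous
  refine le_of_le_off_axis (continuous_abs.comp hΦc) continuous_const (fun z hz => ?_) x
  have hr2 : 0 < cylRadius z ^ 2 := by positivity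
  have h := abs_swirl_le_of_norm_curl_le hax hd hΩ z
  rw [← hax.cylRadius_sq_mul_angVelQuot hu z, abs_mul, abs_of_pos hr2] at h
  have h' : cylRadius z ^ 2 * |angVelQuot u z| ≤ cylRadius z ^ 2 * (Ω / 2) := by
    calc _ ≤ Ω / 2 * cylRadius z ^ 2 := h
      _ = cylRadius z ^ 2 * (Ω / 2) := by ring
  exact le_of_mul_le_mul_left h' hr2

/-- **The constant `½` is attained**: for the rigid rotation `u = J` (`x ↦ (−x₁, x₀, 0)`, `‖curl u‖ ≡ 2`, Majda–Bertozzi's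
rotating example) one has `|Γ(x)| = ½ · ‖curl u(x)‖ · r(x)²` at every point, so `abs_swirl_le_of_norm_curl_le` is sharp.
[new here — dictionary] -/
theorem abs_swirl_rotGen_eq_half_norm_curl_mul (x : EuclideanSpace ℝ (Fin 3)) :
    |swirl rotGen x| = ‖curl rotGen x‖ / 2 * cylRadius x ^ 2 := by
  rw [swirl_rotGen_eq_cylRadius_sq, norm_curl_rotGen, abs_of_nonneg (sq_nonneg _)]
  ring

end Funnel

/-! ### Vorticity Type I ⇒ angular-velocity Type I -/

section Rate

variable {T C : ℝ} {u : ℝ → EuclideanSpace ℝ (Fin 3) → EuclideanSpace ℝ (Fin 3)}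

/-- **The swirl funnel under a vorticity rate.** If the slices `u(t, ·)` are axisymmetric and differentiable for `t`
near `T⁻` and `(T − t)‖curl u(t, x)‖ ≤ C` there, then for `t` near `T⁻` and every `x`:
`(T − t)|Γ(t, x)| ≤ ½ C r(x)²` — the swirl is at most quadratic at the parabolic scale, `|Γ(t, √(T−t)ρe)| ≤ ½Cρ²`
(TEMPLATE (C7)). [new here — dictionary] -/
theorem eventually_abs_swirl_le_of_vorticityRate (hax : ∀ᶠ t in 𝓝[<] T, IsAxisymmetric (u t))
    (hd : ∀ᶠ t in 𝓝[<] T, Differentiable ℝ (u t))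
    (hrate : ∀ᶠ t in 𝓝[<] T, ∀ x, (T - t) * ‖curl (u t) x‖ ≤ C) :
    ∀ᶠ t in 𝓝[<] T, ∀ x, (T - t) * |swirl (u t) x| ≤ C / 2 * cylRadius x ^ 2 := by
  have hlt : ∀ᶠ t in 𝓝[<] T, t < T := eventually_mem_nhdsWithin
  filter_upwards [hax, hd, hrate, hlt] with t hax' hd' hrate' hlt'
  intro x
  have hTt : 0 < T - t := sub_pos.2 hlt'
  have hΩ : ∀ y, ‖curl (u t) y‖ ≤ C / (T - t) := fun y => by
    rw [le_div_iff₀ hTt, mul_comm]; exact hrate' y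
  have h := abs_swirl_le_of_norm_curl_le hax' hd' hΩ x
  calc (T - t) * |swirl (u t) x| ≤ (T - t) * (C / (T - t) / 2 * cylRadius x ^ 2) :=
        mul_le_mul_of_nonneg_left h hTt.le
    _ = C / 2 * cylRadius x ^ 2 := by field_simp

/-- **VORTICITY TYPE I ⇒ ANGULAR-VELOCITY TYPE I** (sharp constant `½`). If the slices `u(t, ·)` are axisymmetric and `C²`
for `t` near `T⁻` and obey the vorticity rate `(T − t)‖curl u(t, x)‖ ≤ C`, then for `t` near `T⁻` and every `x`:
`(T − t)|(u_θ/r)(t, x)| ≤ ½ C`. TEMPLATE (G2): the swirl gauge `λ_b(t) = |u₁(x_c(t), t)|^{−1/2}` of any such family is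
Type-I-slow, `λ_b(t)² ≥ 2(T − t)/C`. [new here — dictionary] -/
theorem eventually_abs_angVelQuot_le_of_vorticityRate (hax : ∀ᶠ t in 𝓝[<] T, IsAxisymmetric (u t))
    (hu : ∀ᶠ t in 𝓝[<] T, ContDiff ℝ 2 (u t))
    (hrate : ∀ᶠ t in 𝓝[<] T, ∀ x, (T - t) * ‖curl (u t) x‖ ≤ C) :
    ∀ᶠ t in 𝓝[<] T, ∀ x, (T - t) * |angVelQuot (u t) x| ≤ C / 2 := by
  have hlt : ∀ᶠ t in 𝓝[<] T, t < T := eventually_mem_nhdsWithin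
  filter_upwards [hax, hu, hrate, hlt] with t hax' hu' hrate' hlt'
  intro x
  have hTt : 0 < T - t := sub_pos.2 hlt'
  have hΩ : ∀ y, ‖curl (u t) y‖ ≤ C / (T - t) := fun y => by
    rw [le_div_iff₀ hTt, mul_comm]; exact hrate' y
  have h := abs_angVelQuot_le_of_norm_curl_le hax' hu' hΩ x
  calc (T - t) * |angVelQuot (u t) x| ≤ (T - t) * (C / (T - t) / 2) := mul_le_mul_of_nonneg_left h hTt.le
    _ = C / 2 := by field_simp

/-- **The swirl gauge N-b is Type-I-slow under a vorticity rate** (TEMPLATE (G2), quantitative form): under the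
hypotheses of `eventually_abs_angVelQuot_le_of_vorticityRate`, for `t` near `T⁻`, at every point `x` where the angular
velocity does not vanish, `2(T − t)/C' ≤ 1/|u₁(t, x)|` for every `C' > 0` with `C ≤ C'` — in particular at the gauge
centre `x_c(t)`: `λ_b(t)² = 1/|u₁(x_c(t), t)| ≥ 2(T − t)/C'`. [new here — dictionary] -/
theorem eventually_swirlGauge_sq_ge_of_vorticityRate (hax : ∀ᶠ t in 𝓝[<] T, IsAxisymmetric (u t))
    (hu : ∀ᶠ t in 𝓝[<] T, ContDiff ℝ 2 (u t))
    (hrate : ∀ᶠ t in 𝓝[<] T, ∀ x, (T - t) * ‖curl (u t) x‖ ≤ C) {C' : ℝ} (hC' : 0 < C') (hCC' : C ≤ C') :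
    ∀ᶠ t in 𝓝[<] T, ∀ x, angVelQuot (u t) x ≠ 0 → 2 * (T - t) / C' ≤ 1 / |angVelQuot (u t) x| := by
  filter_upwards [eventually_abs_angVelQuot_le_of_vorticityRate hax hu hrate] with t ht
  intro x hx
  have hpos : 0 < |angVelQuot (u t) x| := abs_pos.2 hx
  have h : (T - t) * |angVelQuot (u t) x| ≤ C' / 2 := (ht x).trans (by linarith)
  rw [div_le_div_iff₀ hC' hpos]
  nlinarith

end Rate

end TypeIIModulationDictionary
end Summit.NavierStokesRegularity.OSWSelfSimilar
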